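import Summits.CriticalPhenomena.PercolationContinuityZ3.Theorems.PercNearOneGluingNoHeavyLowerTailSahiPair43Check

/-!
# `NoHeavyLowerTail` (crux stmt-CriticalPhenomena-4575), Sahi programme: the cell `(4,3)` — the pair-saturation checker on `[3]^4`,
# PART 2: lane vectors (1024 pairs per big integer), batches, the antichain enumeration and `chunkCheck`

Support file (Sahi cell `prim-sahi`, seat `prim-sahi-typer` gen 31; `--supports stmt-CriticalPhenomena-4575`).  COMPUTABLE DEFINITIONS ONLY
(no theorems, no `sorry`); see PART 1 (`…SahiPair43Check`) for the encoding and the overall description; the soundness theorem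
(`chunkCheck m r = true` for all `r < m` implies `SahiGridPattern.PatternPos 4`) and the `native_decide` evaluations live in companion files.

LANES.  A batch of up to `BATCH = 1024` pairs `(A_i, B_i)` of 81-bit masks is packed into `pa = Σ_i A_i·2^{96 i}`, `pb = Σ_i B_i·2^{96 i}`;
every quantity indexed by (pair, point) is a lane vector `Σ_i v_i·2^{96 i}` with `0 ≤ v_i < 2^90`, so that one big-integer operation acts on
all pairs of the batch (the interpreter cost of `native_decide` is per operation, not per bit).  `satsub` is lane-wise truncated subtraction
(guard bit `GB = 90`), `lmin` lane-wise minimum; `packedProfile` = the y-profiles offset by `BIAS`; `packedGreedy` = the oblivious greedy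
downward transport; `failLanes` = lanes not ending pointwise `≥ BIAS`, re-examined one by one by `pairTest`. [this work]
-/

namespace Summit.CriticalPhenomena.PercolationContinuityZ3.Theorems.SahiGridPattern.Pair43

/-! ### Lane vectors: up to 1024 pairs at once -/

/-- Lane width in bits. [this work] -/
def LW : ℕ := 96

/-- Guard bit position inside a lane (all lane values stay below `2^GB`). [this work] -/
def GB : ℕ := 90

/-- Offset added to every profile value so that lanes stay nonnegative. [this work] -/
def BIAS : ℕ := 4096

/-- `2^GB − 1`: multiplier expanding a 0/1 lane to the mask of the low `GB` bits. [this work] -/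
def FMUL : ℕ := 2 ^ GB - 1

/-- Number of pairs per batch. [this work] -/
def BATCH : ℕ := 1024

/-- `Σ_{i<nb} 2^{LW·i}`: the lane vector with all lanes equal to one. [this work] -/
def ones (nb : ℕ) : ℕ := foldBelow nb (fun i acc => acc + (1 <<< (LW * i))) 0

/-- Lane-wise saturating subtraction `max(x_i − y_i, 0)` (all lanes `< 2^GB`; `one = ones nb`, `g = one <<< GB`). [this work] -/
def satsub (one g x y : ℕ) : ℕ :=
  let d := x + g - y
  (((d >>> GB) &&& one) * FMUL) &&& d

/-- Lane-wise minimum. [this work] -/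
def lmin (one g x y : ℕ) : ℕ := x - satsub one g x y

/-- Lane `i` of a lane vector. [this work] -/
def laneOf (x i : ℕ) : ℕ := (x >>> (LW * i)) % 2 ^ LW

/-- A batch of pairs: number of lanes used and the packed masks `Σ A_i 2^{LW·i}`, `Σ B_i 2^{LW·i}`. [this work] -/
structure Batch where
  /-- number of pairs in the batch -/
  n : ℕ
  /-- packed first sets -/
  pa : ℕ
  /-- packed second sets -/
  pb : ℕ

/-- The empty batch. [this work] -/
def Batch.empty : Batch := ⟨0, 0, 0⟩

/-- Append a pair to a batch. [this work] -/
def Batch.push (b : Batch) (A B : ℕ) : Batch := ⟨b.n + 1, b.pa + (A <<< (LW * b.n)), b.pb + (B <<< (LW * b.n))⟩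

/-- The packed profiles, offset by `BIAS`: entry `y` is the lane vector of `BIAS + c_i(y)`. [this work] -/
def packedProfile (one pa pb : ℕ) : Array ℕ :=
  let α : Array ℕ := Array.ofFn fun x : Fin 81 => (pa >>> x.val) &&& one
  let β : Array ℕ := Array.ofFn fun x : Fin 81 => (pb >>> x.val) &&& one
  let ω : Array ℕ := Array.ofFn fun x : Fin 81 => α.getD x 0 &&& β.getD x 0
  Array.ofFn fun y : Fin 81 =>
    let L := tdL.getD y #[]
    let nuA := L.foldl (fun s qt => s + α.getD qt.1 0) 0
    let nuB := L.foldl (fun s qt => s + β.getD qt.1 0) 0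
    let nuW := L.foldl (fun s qt => s + ω.getD qt.1 0) 0
    let mm := L.foldl (fun s qt => s + (β.getD qt.1 0 &&& α.getD qt.2 0)) 0
    let pos := one * BIAS + (ω.getD y 0 <<< 5) + mm
    let neg := ((β.getD y 0 * FMUL) &&& nuA) + ((α.getD y 0 * FMUL) &&& nuB) + nuW
    pos - neg

/-- One greedy step on lane vectors: `y` pulls `t = min(need, surplus of w)` from `w`; state = (balances, remaining need). [this work] -/
def pullStep (one g biasV y : ℕ) (st : Array ℕ × ℕ) (w : ℕ) : Array ℕ × ℕ :=
  if st.2 == 0 then st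
  else
    let hav := satsub one g (st.1.getD w 0) biasV
    let t := lmin one g st.2 hav
    ((st.1.setIfInBounds w (st.1.getD w 0 - t)).setIfInBounds y (st.1.getD y 0 + t), st.2 - t)

/-- All pulls of one point `y` (from every `w ≥ y`, increasing rank). [this work] -/
def pullAll (one g biasV : ℕ) (u : Array ℕ) (y : ℕ) : Array ℕ :=
  let need0 := satsub one g biasV (u.getD y 0)
  if need0 == 0 then u else ((upList.getD y #[]).foldl (pullStep one g biasV y) (u, need0)).1

/-- The oblivious greedy transport on lane vectors: every `y` (decreasing rank) pulls `min(need, surplus)` from every `w ≥ y`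
(increasing rank). [this work] -/
def packedGreedy (one : ℕ) (u0 : Array ℕ) : Array ℕ :=
  descOrd.foldl (pullAll one (one <<< GB) (one * BIAS)) u0

/-- Lanes (as a 0/1 lane vector) whose transport did not end pointwise `≥ BIAS`. [this work] -/
def failLanes (one : ℕ) (u : Array ℕ) : ℕ :=
  let g := one <<< GB
  let biasV := one * BIAS
  foldBelow 81 (fun y acc => acc ||| (one ^^^ (((u.getD y 0 + g - biasV) >>> GB) &&& one))) 0

/-- **The batch test**: packed profiles, packed greedy; every failing lane is re-examined by the one-pair test. [this work] -/
def packedTest (b : Batch) : Bool :=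
  b.n == 0 ||
    (let one := ones b.n
     let fl := failLanes one (packedGreedy one (packedProfile one b.pa b.pb))
     fl == 0 || allBelow b.n fun i => !(fl.testBit (LW * i)) || pairTest (laneOf b.pa i) (laneOf b.pb i))

/-- Append a pair; run the batch test when `BATCH` pairs are collected (`none` = a test failed). [this work] -/
def pushPair (b : Batch) (A B : ℕ) : Option Batch :=
  let b' := b.push A B
  if b'.n < BATCH then some b' else if packedTest b' then some Batch.empty else none

/-! ### Colourings of one antichain, and the enumeration -/

/-- The down-set masks of the two colour classes of the colouring `mm` of the points `pts` (`pts[0]` in the first class, `pts[j+1]` in the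
first class iff bit `j` of `mm`), accumulated over the first `j` points. [this work] -/
def classDown (pts : Array ℕ) (mm : ℕ) : ℕ → ℕ × ℕ
  | 0 => (0, 0)
  | j + 1 =>
    let acc := classDown pts mm j
    let x := pts.getD j 0
    if j = 0 ∨ mm.testBit (j - 1) then (acc.1 ||| downT.getD x 0, acc.2) else (acc.1, acc.2 ||| downT.getD x 0)

/-- The normal-form filter: a minimal element of one set lies in the other set and above a point of `N`. [this work] -/
def p2bad (A B upN : ℕ) : Bool := (((minMask A &&& B) ||| (minMask B &&& A)) &&& upN) != 0

/-- Process one colouring: filter, else append the pair `(A,B)` to the batch. [this work] -/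
def colourStep (pts : Array ℕ) (f upN : ℕ) (mm : ℕ) (ob : Option Batch) : Option Batch :=
  match ob with
  | none => none
  | some b =>
    let n := pts.size
    let nA := 1 + countBelow (n - 1) fun j => mm.testBit j
    let nB := n - nA
    if f < nA ∨ f < nB then some b
    else
      let dd := classDown pts mm n
      let A := compl81 dd.1
      let B := compl81 dd.2
      if p2bad A B upN then some b else pushPair b A B

/-- All colourings of the antichain `pts` (nothing to do for the empty antichain). [this work] -/
def nodeColourings (pts : Array ℕ) (ob : Option Batch) : Option Batch :=
  if pts.size = 0 then ob
  else
    let free := compl81 (orTab cmpT pts)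
    let f := chainCount free
    let upN := orTab upT pts
    foldBelow (1 <<< (pts.size - 1)) (colourStep pts f upN) ob

/-- Chunk hash of an array of codes. [this work] -/
def ptsHash (pts : Array ℕ) : ℕ := pts.foldl (fun s x => (s * 89 + x + 1) % 1000003) 7

/-- Node test: symmetry representative (sorted signature) and chunk selection, then the colourings. [this work] -/
def nodeStep (m r : ℕ) (pts : Array ℕ) (s0 s1 s2 s3 : ℕ) (ob : Option Batch) : Option Batch :=
  if decide (s0 ≤ s1) && decide (s1 ≤ s2) && decide (s2 ≤ s3) && (ptsHash pts % m == r) then nodeColourings pts ob else ob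

/-- Code of the lowest set bit of a nonzero mask. [this work] -/
def lowBit (c : ℕ) : ℕ := (c ^^^ (c &&& (c - 1))).log2

/-- **Enumeration of all antichains** extending `pts` by candidates from `cand` (all codes in `cand` exceed those of `pts` and are
incomparable to them), lowest candidate first, threading the batch; `s0..s3` is the axis signature of `pts`. [this work] -/
def walk (m r : ℕ) : ℕ → Array ℕ → ℕ → ℕ → ℕ → ℕ → ℕ → Option Batch → Option Batch
  | 0, _, _, _, _, _, _, ob => ob
  | fuel + 1, pts, s0, s1, s2, s3, cand, ob =>
    match ob with
    | none => none
    | some b =>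
      if cand = 0 then some b
      else
        let x := lowBit cand
        let above := cand &&& nextT.getD x 0
        let pts' := pts.push x
        let t0 := s0 + sw 0 x
        let t1 := s1 + sw 1 x
        let t2 := s2 + sw 2 x
        let t3 := s3 + sw 3 x
        let ob1 := nodeStep m r pts' t0 t1 t2 t3 (some b)
        let ob2 := walk m r fuel pts' t0 t1 t2 t3 above ob1
        walk m r fuel pts s0 s1 s2 s3 (cand ^^^ (1 <<< x)) ob2

/-- **The chunk check**: all antichains of `[3]^4`; colourings of chunk `r` of `m` batched and tested; the final partial batch tested.
[this work] -/
def chunkCheck (m r : ℕ) : Bool :=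
  match walk m r 83 #[] 0 0 0 0 FULL (nodeStep m r #[] 0 0 0 0 (some Batch.empty)) with
  | none => false
  | some b => packedTest b

end Summit.CriticalPhenomena.PercolationContinuityZ3.Theorems.SahiGridPattern.Pair43
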